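import Mathlib
import Summits.HodgeConjecture.FermatCycles.HodgeFermatSevenFive
import Summits.HodgeConjecture.FermatCycles.HodgeFermatDecodingC

/-!
# THEOREM L assembled: the pattern of a jointly primitive coincidence at the primes 5, 7, 13 (`HodgeFermat/RowsFinal.lean`; HF-G29f)

Tree copy (whole module) of the module `HodgeFermat/RowsFinal.lean` of the sibling cell's standalone package
`run/shared/lean/pub/pub-hodgefermat/lean/HodgeFermat/` (380 lines, sha256 `9047554b243d499d…`), source lines 31–380 (all: normal forms, the row predicates `RowUZ1`/`RowZ1Z1`, `pattern_of_rows`, the patterns at 7, 13 and 5).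
Filed by cell `pub-hfermat`, seat prover-1 gen-3, on the COORDINATOR KEEPER RULING of 2026-08-25 (gem sweep H1: take the
off-gate kernel theorem `thmFstar` through the gate) — here THEOREM F* of `tables/DPRIME-THEOREM.md` §9 IN FULL, i.e.
PROPOSITION D′(3N) and the descent (`HodgeFermat/PropDPrimeNFinal.lean`, GATE HF-G34), the last off-gate form of THEOREM F*
(its first two forms, `DecodingFinal.thmFstar` = F* at the prime levels and `ThmFstarNFinal.thmFstar` = F*(3N), landed on
2026-08-25 as `HodgeFermatThmFstar.lean` / `HodgeFermatThmFstarN.lean`, seats prover-1 gen-0 / gen-2); this file is one link of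
the import closure of `PropDPrimeNFinal.propDprime` (the sibling's KR-free chain: THEOREM L, COROLLARY M, THEOREM D6,
THEOREM U⁺, THEOREM KR6, THEOREM Z3U) on top of those landed chains.  The source module is the sibling's hub-checked module of
record (pub-hodgefermat `CERT.md` l.945, GATE HF-G29f; cell record `check/RowsFinal_standalone.lean` sha256 `52051d22b7de9016…`); its declarations are copied VERBATIM.
Deviations from the source module, exhaustively: the `import` lines (tree modules `Summits.HodgeConjecture.FermatCycles.
HodgeFermat*` instead of `HodgeFermat.*`); this module docstring; DEDUP (pre-empting the gate's `dedup.landed`): the seven generic lemmas of the source's §1 — `st_symm` (l.39–40), `st_trans` (l.42–43), `unit_mul_not_dvd` (l.45–46), `rsum_swap` (l.48–49), `rsum_rot` (l.51–52), `st_swap` (l.54–60), `st_rot` (l.62–68) — are VERBATIM the landed `HodgeFermat.KRFree.Decoding.*` lemmas of `HodgeFermatDecodingC.lean` (which says so: «cf. `RowsFinal`») and are DELETED, re-bound by the added line `open HodgeFermat.KRFree.Decoding (st_symm st_trans unit_mul_not_dvd rsum_swap rsum_rot st_swap st_rot)` (extra import); downstream `open HodgeFermat.KRFree.RowsFinal (…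 st_symm …)` lines are adjusted accordingly in those files.
Every other line — in particular every declaration's statement and proof — is byte-identical to the source.
HONEST FRAMING: explicit algebraic cycles for specific Hodge classes on Fermat/Delsarte varieties; residual open instances
listed; no claim on general Hodge.  (This file is arithmetic of CM types / finite combinatorics / analytic number theory
of the sibling's KR-free programme; it claims nothing about cycles.)

The source module's docstring (RowsFinal.lean l.3–29), verbatim:

## HodgeFermat/RowsFinal.lean — generation 29 (fifth addendum, HF-G29f) of the hodge-fermat build

THEOREM L (`tables/DPRIME-THEOREM.md` §3) AS KERNEL STATEMENTS IN FINAL FORM, ONE PER PRIME: "(U, U) ONLY".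
Let m = pn with p prime, p ∤ n, n odd, and let T = (a, b, c), T′ = (a′, b′, c′) be triples of level m with zero sum mod m,
no entry ≡ 0 (mod m) and the same CM type (`SameType (p * n)` of `LemmaN.lean`).  `pattern_of_rows` packages the four rows of
THEOREM L at p — (Z3, U) `TheoremL.row_Z3U` and (Z3, Z1) `TheoremL.row_Z3Z1_seven` (generations 20/21, every p ≥ 7), and the
rows (U, Z1) "impossible", (Z1, Z1) "py ≡ py′ (mod m)" supplied as hypotheses — into ONE conclusion: EITHER all six entries are
prime to p (pattern (U, U)) OR there are p-divisible entries u ∈ T, v ∈ T′ with u ≡ v (mod m); hence (`UU_of_rows`) a DISJOINT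
pair is (U, U) at p.  Joint primitivity enters through a parameter `R : ℕ → Prop` with `¬ R p`: the hypothesis
`∀ q prime, q ∣ pn → q ∣ all six entries → R q` is joint primitivity AT p for `R q := (q ≠ p)` and FULL joint primitivity
for `R q := False` (the form the p = 11 row `RowUZ1Eleven.row_UZ1_eleven` consumes).  Instances proved here, for every
odd n (squarefree or not):
* `seven_pattern`, `seven_UU` — p = 7 (rows `SevenFive.uz1_seven`, `z1z1_seven`, HF-G29d/e): THEOREM L's row "p = 7" reads
  "(U, U) only" — the alternative "(Z1, Z1) with 5 ∣ n, 7y ≡ 7y′ (mod m/5)" of the hand proof does not occur;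
* `thirteen_pattern`, `thirteen_UU` — every prime p ≥ 13 (rows `TheoremL.row_UZ1_ge_thirteen`, `row_Z1Z1_eleven`);
* `five_pattern` — p = 5 (rows `TheoremL.row_Z3U`, `row_Z3Z1_five`, generations 20/21): neither triple is Z3 at 5 (patterns among
  (U, U), (U, Z1), (Z1, Z1), which all occur), or 3 ∣ n and a 5-divisible entry is ≡ ±m/3 (mod m) — THEOREM L's row "p = 5".
The prime 11 (row `row_UZ1_eleven`: squarefree n, full joint primitivity, certificate F33) is packaged in `ElevenFinal.lean`,
together with the single statement "p ≥ 7 ⟹ (U, U)" at squarefree odd levels; the row "p = 3" of THEOREM L — (Z3, U) forces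
m = 21 — is THEOREM Z3U, `TheoremZ3U.z3u` (HF-G29), so that EVERY ROW of THEOREM L is now a kernel statement.

The proof is the case analysis over the patterns of T and T′ at p (U = no entry divisible by p, Z1 = exactly one, Z3 = all
three; exactly two is impossible by the zero sum); a Z1 entry is first moved to the front by the permutation lemmas `st_swap`,
`st_rot` (re-proved from `LemmaN.rsum_cases` as in `Bridge.lean`, keeping the module LIGHT: it imports `SevenFive` only).
No `sorry`, no `decide`, no `native_decide`, no axiom beyond [propext, Classical.choice, Quot.sound].
-/

set_option autoImplicit false

namespace HodgeFermat.KRFree.RowsFinal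

open HodgeFermat.KRFree.LemmaN HodgeFermat.KRFree.TheoremL HodgeFermat.KRFree.SevenFive

open HodgeFermat.KRFree.Decoding (st_symm st_trans unit_mul_not_dvd rsum_swap rsum_rot st_swap st_rot)

/-! ## 1. Permuting the entries (cf. `Bridge.sameType_swap`, `sameType_rot`) -/


/-! ## 2. Normal form of a triple at the prime p: pattern U, Z1 with the p-divisible entry FIRST, or Z3 -/

/-- every zero-sum triple of level `N`, `p ∣ N`, with no entry `≡ 0 (mod N)` is, after one of the permutations id, (12), (132)
— which preserve the CM type and the set of common divisors —, of pattern U, Z1 with the p-divisible entry in the first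
position, or Z3 at p (exactly two p-divisible entries cannot occur) -/
lemma normalise {p N a b c : ℕ} (hN : 0 < N) (hpN : p ∣ N) (hs : N ∣ a + b + c) (ha : ¬ N ∣ a) (hb : ¬ N ∣ b)
    (hc : ¬ N ∣ c) :
    ∃ a₁ b₁ c₁, ((a₁ = a ∧ b₁ = b ∧ c₁ = c) ∨ (a₁ = b ∧ b₁ = a ∧ c₁ = c) ∨ (a₁ = c ∧ b₁ = a ∧ c₁ = b)) ∧
      SameType N (a₁, b₁, c₁) (a, b, c) ∧ N ∣ a₁ + b₁ + c₁ ∧ ¬ N ∣ a₁ ∧ ¬ N ∣ b₁ ∧ ¬ N ∣ c₁ ∧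
      (∀ q, q ∣ a₁ → q ∣ b₁ → q ∣ c₁ → q ∣ a ∧ q ∣ b ∧ q ∣ c) ∧
      ((¬ p ∣ a₁ ∧ ¬ p ∣ b₁ ∧ ¬ p ∣ c₁) ∨ (p ∣ a₁ ∧ ¬ p ∣ b₁ ∧ ¬ p ∣ c₁) ∨ (p ∣ a₁ ∧ p ∣ b₁ ∧ p ∣ c₁)) := by
  have hps : p ∣ a + b + c := dvd_trans hpN hs
  have refl₃ : SameType N (a, b, c) (a, b, c) := fun _ _ => Iff.rfl
  have idq : ∀ q, q ∣ a → q ∣ b → q ∣ c → q ∣ a ∧ q ∣ b ∧ q ∣ c := fun _ h1 h2 h3 => ⟨h1, h2, h3⟩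
  by_cases hpa : p ∣ a <;> by_cases hpb : p ∣ b <;> by_cases hpc : p ∣ c
  · exact ⟨a, b, c, Or.inl ⟨rfl, rfl, rfl⟩, refl₃, hs, ha, hb, hc, idq, Or.inr (Or.inr ⟨hpa, hpb, hpc⟩)⟩
  · exact absurd ((Nat.dvd_add_right (dvd_add hpa hpb)).mp hps) hpc
  · exact absurd ((Nat.dvd_add_right (dvd_add hpa hpc)).mp (by rwa [Nat.add_right_comm] at hps)) hpb
  · exact ⟨a, b, c, Or.inl ⟨rfl, rfl, rfl⟩, refl₃, hs, ha, hb, hc, idq, Or.inr (Or.inl ⟨hpa, hpb, hpc⟩)⟩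
  · exact absurd ((Nat.dvd_add_right (dvd_add hpb hpc)).mp (by rwa [show a + b + c = b + c + a by ring] at hps)) hpa
  · exact ⟨b, a, c, Or.inr (Or.inl ⟨rfl, rfl, rfl⟩), st_swap hN (by rwa [Nat.add_comm b a]) hc,
      by rwa [Nat.add_comm b a], hb, ha, hc, fun _ h1 h2 h3 => ⟨h2, h1, h3⟩, Or.inr (Or.inl ⟨hpb, hpa, hpc⟩)⟩
  · exact ⟨c, a, b, Or.inr (Or.inr ⟨rfl, rfl, rfl⟩), st_symm (st_rot hN hs hb hc),
      by rwa [show c + a + b = a + b + c by ring], hc, ha, hb, fun _ h1 h2 h3 => ⟨h2, h3, h1⟩,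
      Or.inr (Or.inl ⟨hpc, hpa, hpb⟩)⟩
  · exact ⟨a, b, c, Or.inl ⟨rfl, rfl, rfl⟩, refl₃, hs, ha, hb, hc, idq, Or.inl ⟨hpa, hpb, hpc⟩⟩

/-- transporting "all entries prime to p" back along the normalising permutation -/
lemma units_back {p a b c a₁ b₁ c₁ : ℕ}
    (hperm : (a₁ = a ∧ b₁ = b ∧ c₁ = c) ∨ (a₁ = b ∧ b₁ = a ∧ c₁ = c) ∨ (a₁ = c ∧ b₁ = a ∧ c₁ = b))
    (h1 : ¬ p ∣ a₁) (h2 : ¬ p ∣ b₁) (h3 : ¬ p ∣ c₁) : ¬ p ∣ a ∧ ¬ p ∣ b ∧ ¬ p ∣ c := by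
  rcases hperm with ⟨rfl, rfl, rfl⟩ | ⟨rfl, rfl, rfl⟩ | ⟨rfl, rfl, rfl⟩
  · exact ⟨h1, h2, h3⟩
  · exact ⟨h2, h1, h3⟩
  · exact ⟨h2, h3, h1⟩

/-- the first entry of the normalised triple is an entry of the original one -/
lemma mem_back {a b c a₁ b₁ c₁ : ℕ}
    (hperm : (a₁ = a ∧ b₁ = b ∧ c₁ = c) ∨ (a₁ = b ∧ b₁ = a ∧ c₁ = c) ∨ (a₁ = c ∧ b₁ = a ∧ c₁ = b)) :
    a₁ = a ∨ a₁ = b ∨ a₁ = c := by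
  rcases hperm with ⟨h, -, -⟩ | ⟨h, -, -⟩ | ⟨h, -, -⟩
  · exact Or.inl h
  · exact Or.inr (Or.inl h)
  · exact Or.inr (Or.inr h)

/-! ## 3. The packaging: the four rows at p ⟹ "(U, U), or a shared p-divisible entry" -/

section Rows

variable (p n : ℕ) (R : ℕ → Prop)

/-- the row (U, Z1) at p in final form ("impossible"), with a joint-primitivity premise of shape `R` -/
def RowUZ1 : Prop :=
  ∀ y x₂ x₃ x' y' z' : ℕ, p * n ∣ p * y + x₂ + x₃ → ¬ p ∣ x₂ → ¬ p ∣ x₃ → p * n ∣ x' + y' + z' →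
    ¬ p ∣ x' → ¬ p ∣ y' → ¬ p ∣ z' → ¬ n ∣ y →
    (∀ q, Nat.Prime q → q ∣ p * n → q ∣ p * y → q ∣ x₂ → q ∣ x₃ → q ∣ x' → q ∣ y' → q ∣ z' → R q) →
    SameType (p * n) (p * y, x₂, x₃) (x', y', z') → False

/-- the row (Z1, Z1) at p in final form ("py ≡ py′ (mod pn)") -/
def RowZ1Z1 : Prop :=
  ∀ y x₂ x₃ y' x₂' x₃' : ℕ, p * n ∣ p * y + x₂ + x₃ → ¬ p ∣ x₂ → ¬ p ∣ x₃ → p * n ∣ p * y' + x₂' + x₃' →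
    ¬ p ∣ x₂' → ¬ p ∣ x₃' → SameType (p * n) (p * y, x₂, x₃) (p * y', x₂', x₃') → y ≡ y' [MOD n]

end Rows

/-- the case analysis for triples in normal form -/
lemma core {p n : ℕ} {R : ℕ → Prop} (hp : p.Prime) (h7 : 7 ≤ p) (hpn : ¬ p ∣ n) (hn : 0 < n) (hodd : Odd n)
    (hR : ¬ R p) (rowUZ1 : RowUZ1 p n R) (rowZ1Z1 : RowZ1Z1 p n)
    {a b c a' b' c' : ℕ}
    (hs : p * n ∣ a + b + c) (ha : ¬ p * n ∣ a) (hs' : p * n ∣ a' + b' + c') (ha' : ¬ p * n ∣ a')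
    (hpat : (¬ p ∣ a ∧ ¬ p ∣ b ∧ ¬ p ∣ c) ∨ (p ∣ a ∧ ¬ p ∣ b ∧ ¬ p ∣ c) ∨ (p ∣ a ∧ p ∣ b ∧ p ∣ c))
    (hpat' : (¬ p ∣ a' ∧ ¬ p ∣ b' ∧ ¬ p ∣ c') ∨ (p ∣ a' ∧ ¬ p ∣ b' ∧ ¬ p ∣ c') ∨ (p ∣ a' ∧ p ∣ b' ∧ p ∣ c'))
    (hJ : ∀ q, Nat.Prime q → q ∣ p * n → q ∣ a → q ∣ b → q ∣ c → q ∣ a' → q ∣ b' → q ∣ c' → R q)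
    (hH : SameType (p * n) (a, b, c) (a', b', c')) :
    (¬ p ∣ a ∧ ¬ p ∣ b ∧ ¬ p ∣ c ∧ ¬ p ∣ a' ∧ ¬ p ∣ b' ∧ ¬ p ∣ c') ∨ (p ∣ a ∧ p ∣ a' ∧ a ≡ a' [MOD p * n]) := by
  have h5 : 5 ≤ p := by omega
  have ny : ∀ {y : ℕ}, ¬ p * n ∣ p * y → ¬ n ∣ y := fun h hy => h (Nat.mul_dvd_mul_left p hy)
  have hJ' : ∀ q, Nat.Prime q → q ∣ p * n → q ∣ a' → q ∣ b' → q ∣ c' → q ∣ a → q ∣ b → q ∣ c → R q :=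
    fun q hq hqn h4 h5 h6 h1 h2 h3 => hJ q hq hqn h1 h2 h3 h4 h5 h6
  rcases hpat with hU | hZ1 | hZ3 <;> rcases hpat' with hU' | hZ1' | hZ3'
  · exact Or.inl ⟨hU.1, hU.2.1, hU.2.2, hU'.1, hU'.2.1, hU'.2.2⟩
  · -- (U, Z1)
    obtain ⟨⟨y', rfl⟩, hb', hc'⟩ := hZ1'
    exact (rowUZ1 y' b' c' a b c hs' hb' hc' hs hU.1 hU.2.1 hU.2.2 (ny ha') hJ' (st_symm hH)).elim
  · -- (U, Z3)
    obtain ⟨⟨a₀, rfl⟩, ⟨b₀, rfl⟩, ⟨c₀, rfl⟩⟩ := hZ3'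
    exact (row_Z3U p n a₀ b₀ c₀ a b c hp h5 hpn hn hs hU.1 hU.2.1 hU.2.2 (st_symm hH)).elim
  · -- (Z1, U)
    obtain ⟨⟨y, rfl⟩, hb, hc⟩ := hZ1
    exact (rowUZ1 y b c a' b' c' hs hb hc hs' hU'.1 hU'.2.1 hU'.2.2 (ny ha) hJ hH).elim
  · -- (Z1, Z1): the p-divisible entries are congruent mod pn
    obtain ⟨⟨y, rfl⟩, hb, hc⟩ := hZ1
    obtain ⟨⟨y', rfl⟩, hb', hc'⟩ := hZ1'
    exact Or.inr ⟨⟨y, rfl⟩, ⟨y', rfl⟩, Nat.ModEq.mul_left' p (rowZ1Z1 y b c y' b' c' hs hb hc hs' hb' hc' hH)⟩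
  · -- (Z1, Z3)
    obtain ⟨⟨y, rfl⟩, hb, hc⟩ := hZ1
    obtain ⟨⟨a₀, rfl⟩, ⟨b₀, rfl⟩, ⟨c₀, rfl⟩⟩ := hZ3'
    exact (row_Z3Z1_seven p n a₀ b₀ c₀ y b c hp h7 hpn hn hodd hs hb hc (ny ha) (st_symm hH)).elim
  · -- (Z3, U)
    obtain ⟨⟨a₀, rfl⟩, ⟨b₀, rfl⟩, ⟨c₀, rfl⟩⟩ := hZ3
    exact (row_Z3U p n a₀ b₀ c₀ a' b' c' hp h5 hpn hn hs' hU'.1 hU'.2.1 hU'.2.2 hH).elim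
  · -- (Z3, Z1)
    obtain ⟨⟨a₀, rfl⟩, ⟨b₀, rfl⟩, ⟨c₀, rfl⟩⟩ := hZ3
    obtain ⟨⟨y', rfl⟩, hb', hc'⟩ := hZ1'
    exact (row_Z3Z1_seven p n a₀ b₀ c₀ y' b' c' hp h7 hpn hn hodd hs' hb' hc' (ny ha') hH).elim
  · -- (Z3, Z3): excluded by joint primitivity at p
    exact (hR (hJ p hp (dvd_mul_right p n) hZ3.1 hZ3.2.1 hZ3.2.2 hZ3'.1 hZ3'.2.1 hZ3'.2.2)).elim

/-- **THEOREM L at the prime p, packaged.**  If the rows (U, Z1) "impossible" and (Z1, Z1) "py ≡ py′" hold at p (p ≥ 7, so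
that the rows (Z3, U), (Z3, Z1) of `TheoremLRows.lean` apply), then two zero-sum triples of level `pn` (n odd, p ∤ n) with no
entry `≡ 0`, jointly primitive in the sense `R` and of the same CM type are either both all-unit at p — pattern (U, U) — or have
p-divisible entries `u ∈ T`, `v ∈ T′` with `u ≡ v (mod pn)`. -/
theorem pattern_of_rows (p n : ℕ) (R : ℕ → Prop) (hp : p.Prime) (h7 : 7 ≤ p) (hpn : ¬ p ∣ n) (hn : 0 < n)
    (hodd : Odd n) (hR : ¬ R p) (rowUZ1 : RowUZ1 p n R) (rowZ1Z1 : RowZ1Z1 p n)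
    (a b c a' b' c' : ℕ)
    (hs : p * n ∣ a + b + c) (ha : ¬ p * n ∣ a) (hb : ¬ p * n ∣ b) (hc : ¬ p * n ∣ c)
    (hs' : p * n ∣ a' + b' + c') (ha' : ¬ p * n ∣ a') (hb' : ¬ p * n ∣ b') (hc' : ¬ p * n ∣ c')
    (hJ : ∀ q, Nat.Prime q → q ∣ p * n → q ∣ a → q ∣ b → q ∣ c → q ∣ a' → q ∣ b' → q ∣ c' → R q)
    (hH : SameType (p * n) (a, b, c) (a', b', c')) :
    (¬ p ∣ a ∧ ¬ p ∣ b ∧ ¬ p ∣ c ∧ ¬ p ∣ a' ∧ ¬ p ∣ b' ∧ ¬ p ∣ c') ∨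
    (∃ u v, (u = a ∨ u = b ∨ u = c) ∧ (v = a' ∨ v = b' ∨ v = c') ∧ p ∣ u ∧ p ∣ v ∧ u ≡ v [MOD p * n]) := by
  have hN : 0 < p * n := Nat.mul_pos hp.pos hn
  have hpN : p ∣ p * n := dvd_mul_right p n
  obtain ⟨a₁, b₁, c₁, hperm, hS, hs₁, ha₁, hb₁, hc₁, hz₁, hp₁⟩ := normalise (p := p) hN hpN hs ha hb hc
  obtain ⟨a₂, b₂, c₂, hperm', hS', hs₂, ha₂, hb₂, hc₂, hz₂, hp₂⟩ := normalise (p := p) hN hpN hs' ha' hb' hc'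
  have hH₁ : SameType (p * n) (a₁, b₁, c₁) (a₂, b₂, c₂) := st_trans hS (st_trans hH (st_symm hS'))
  have hJ₁ : ∀ q, Nat.Prime q → q ∣ p * n → q ∣ a₁ → q ∣ b₁ → q ∣ c₁ → q ∣ a₂ → q ∣ b₂ → q ∣ c₂ → R q := by
    intro q hq hqn h1 h2 h3 h4 h5 h6
    obtain ⟨k1, k2, k3⟩ := hz₁ q h1 h2 h3
    obtain ⟨k4, k5, k6⟩ := hz₂ q h4 h5 h6
    exact hJ q hq hqn k1 k2 k3 k4 k5 k6
  rcases core hp h7 hpn hn hodd hR rowUZ1 rowZ1Z1 hs₁ ha₁ hs₂ ha₂ hp₁ hp₂ hJ₁ hH₁ with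
    ⟨h1, h2, h3, h4, h5, h6⟩ | ⟨hu, hv, huv⟩
  · obtain ⟨k1, k2, k3⟩ := units_back hperm h1 h2 h3
    obtain ⟨k4, k5, k6⟩ := units_back hperm' h4 h5 h6
    exact Or.inl ⟨k1, k2, k3, k4, k5, k6⟩
  · exact Or.inr ⟨a₁, a₂, mem_back hperm, mem_back hperm', hu, hv, huv⟩

/-- **(U, U) only.**  Under the hypotheses of `pattern_of_rows`, a DISJOINT pair (no entry of `T` congruent mod `pn` to an
entry of `T′`) has all six entries prime to p. -/
theorem UU_of_rows (p n : ℕ) (R : ℕ → Prop) (hp : p.Prime) (h7 : 7 ≤ p) (hpn : ¬ p ∣ n) (hn : 0 < n)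
    (hodd : Odd n) (hR : ¬ R p) (rowUZ1 : RowUZ1 p n R) (rowZ1Z1 : RowZ1Z1 p n)
    (a b c a' b' c' : ℕ)
    (hs : p * n ∣ a + b + c) (ha : ¬ p * n ∣ a) (hb : ¬ p * n ∣ b) (hc : ¬ p * n ∣ c)
    (hs' : p * n ∣ a' + b' + c') (ha' : ¬ p * n ∣ a') (hb' : ¬ p * n ∣ b') (hc' : ¬ p * n ∣ c')
    (hJ : ∀ q, Nat.Prime q → q ∣ p * n → q ∣ a → q ∣ b → q ∣ c → q ∣ a' → q ∣ b' → q ∣ c' → R q)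
    (hD : ∀ u v, (u = a ∨ u = b ∨ u = c) → (v = a' ∨ v = b' ∨ v = c') → ¬ u ≡ v [MOD p * n])
    (hH : SameType (p * n) (a, b, c) (a', b', c')) :
    ¬ p ∣ a ∧ ¬ p ∣ b ∧ ¬ p ∣ c ∧ ¬ p ∣ a' ∧ ¬ p ∣ b' ∧ ¬ p ∣ c' :=
  (pattern_of_rows p n R hp h7 hpn hn hodd hR rowUZ1 rowZ1Z1 a b c a' b' c' hs ha hb hc hs' ha' hb' hc' hJ
    hH).resolve_right fun ⟨u, v, hu, hv, _, _, huv⟩ => hD u v hu hv huv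

/-! ## 4. The instances p = 7 and p ≥ 13 (every odd n; joint primitivity AT p only) -/

/-- joint primitivity at p in the `R`-form with `R q := q ≠ p` -/
lemma jp_at {p n a b c a' b' c' : ℕ} (hJP : ¬ (p ∣ a ∧ p ∣ b ∧ p ∣ c ∧ p ∣ a' ∧ p ∣ b' ∧ p ∣ c')) :
    ∀ q, Nat.Prime q → q ∣ p * n → q ∣ a → q ∣ b → q ∣ c → q ∣ a' → q ∣ b' → q ∣ c' → q ≠ p := by
  rintro q - - h1 h2 h3 h4 h5 h6 rfl
  exact hJP ⟨h1, h2, h3, h4, h5, h6⟩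

/-- **THEOREM L, row p = 7 (final form, every odd n with 7 ∤ n).**  Two zero-sum triples of level `7n` with no entry `≡ 0`,
not all six entries divisible by 7, of the same CM type: pattern (U, U), or 7-divisible entries `u ∈ T`, `v ∈ T′` with
`u ≡ v (mod 7n)`. -/
theorem seven_pattern (n a b c a' b' c' : ℕ) (h7n : ¬ 7 ∣ n) (hn : 0 < n) (hodd : Odd n)
    (hs : 7 * n ∣ a + b + c) (ha : ¬ 7 * n ∣ a) (hb : ¬ 7 * n ∣ b) (hc : ¬ 7 * n ∣ c)
    (hs' : 7 * n ∣ a' + b' + c') (ha' : ¬ 7 * n ∣ a') (hb' : ¬ 7 * n ∣ b') (hc' : ¬ 7 * n ∣ c')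
    (hJP : ¬ (7 ∣ a ∧ 7 ∣ b ∧ 7 ∣ c ∧ 7 ∣ a' ∧ 7 ∣ b' ∧ 7 ∣ c'))
    (hH : SameType (7 * n) (a, b, c) (a', b', c')) :
    (¬ 7 ∣ a ∧ ¬ 7 ∣ b ∧ ¬ 7 ∣ c ∧ ¬ 7 ∣ a' ∧ ¬ 7 ∣ b' ∧ ¬ 7 ∣ c') ∨
    (∃ u v, (u = a ∨ u = b ∨ u = c) ∧ (v = a' ∨ v = b' ∨ v = c') ∧ 7 ∣ u ∧ 7 ∣ v ∧ u ≡ v [MOD 7 * n]) :=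
  pattern_of_rows 7 n (fun q => q ≠ 7) (by norm_num) le_rfl h7n hn hodd (fun h => h rfl)
    (fun y x₂ x₃ x' y' z' h1 h2 h3 h4 h5 h6 h7 h8 _ h9 => uz1_seven n y x₂ x₃ x' y' z' h7n hn hodd h1 h2 h3 h4 h5 h6 h7 h8 h9)
    (fun y x₂ x₃ y' x₂' x₃' h1 h2 h3 h4 h5 h6 h7 => z1z1_seven n y x₂ x₃ y' x₂' x₃' h7n hn hodd h1 h2 h3 h4 h5 h6 h7)
    a b c a' b' c' hs ha hb hc hs' ha' hb' hc' (jp_at hJP) hH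

/-- **THEOREM L, row p = 7: (U, U) ONLY** (every odd n, 7 ∤ n; disjoint pair, not all six entries divisible by 7). -/
theorem seven_UU (n a b c a' b' c' : ℕ) (h7n : ¬ 7 ∣ n) (hn : 0 < n) (hodd : Odd n)
    (hs : 7 * n ∣ a + b + c) (ha : ¬ 7 * n ∣ a) (hb : ¬ 7 * n ∣ b) (hc : ¬ 7 * n ∣ c)
    (hs' : 7 * n ∣ a' + b' + c') (ha' : ¬ 7 * n ∣ a') (hb' : ¬ 7 * n ∣ b') (hc' : ¬ 7 * n ∣ c')
    (hJP : ¬ (7 ∣ a ∧ 7 ∣ b ∧ 7 ∣ c ∧ 7 ∣ a' ∧ 7 ∣ b' ∧ 7 ∣ c'))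
    (hD : ∀ u v, (u = a ∨ u = b ∨ u = c) → (v = a' ∨ v = b' ∨ v = c') → ¬ u ≡ v [MOD 7 * n])
    (hH : SameType (7 * n) (a, b, c) (a', b', c')) :
    ¬ 7 ∣ a ∧ ¬ 7 ∣ b ∧ ¬ 7 ∣ c ∧ ¬ 7 ∣ a' ∧ ¬ 7 ∣ b' ∧ ¬ 7 ∣ c' :=
  (seven_pattern n a b c a' b' c' h7n hn hodd hs ha hb hc hs' ha' hb' hc' hJP hH).resolve_right
    fun ⟨u, v, hu, hv, _, _, huv⟩ => hD u v hu hv huv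

/-- **THEOREM L, rows p ≥ 13 (final form, every odd n with p ∤ n).** -/
theorem thirteen_pattern (p n a b c a' b' c' : ℕ) (hp : p.Prime) (h13 : 13 ≤ p) (hpn : ¬ p ∣ n) (hn : 0 < n)
    (hodd : Odd n)
    (hs : p * n ∣ a + b + c) (ha : ¬ p * n ∣ a) (hb : ¬ p * n ∣ b) (hc : ¬ p * n ∣ c)
    (hs' : p * n ∣ a' + b' + c') (ha' : ¬ p * n ∣ a') (hb' : ¬ p * n ∣ b') (hc' : ¬ p * n ∣ c')
    (hJP : ¬ (p ∣ a ∧ p ∣ b ∧ p ∣ c ∧ p ∣ a' ∧ p ∣ b' ∧ p ∣ c'))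
    (hH : SameType (p * n) (a, b, c) (a', b', c')) :
    (¬ p ∣ a ∧ ¬ p ∣ b ∧ ¬ p ∣ c ∧ ¬ p ∣ a' ∧ ¬ p ∣ b' ∧ ¬ p ∣ c') ∨
    (∃ u v, (u = a ∨ u = b ∨ u = c) ∧ (v = a' ∨ v = b' ∨ v = c') ∧ p ∣ u ∧ p ∣ v ∧ u ≡ v [MOD p * n]) :=
  pattern_of_rows p n (fun q => q ≠ p) hp (by omega) hpn hn hodd (fun h => h rfl)
    (fun y x₂ x₃ x' y' z' h1 h2 h3 h4 h5 h6 h7 h8 _ h9 =>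
      row_UZ1_ge_thirteen p n y x₂ x₃ x' y' z' hp h13 hpn hn hodd h1 h2 h3 h4 h5 h6 h7 h8 h9)
    (fun y x₂ x₃ y' x₂' x₃' h1 h2 h3 h4 h5 h6 h7 => by
      by_contra hyy'
      exact row_Z1Z1_eleven p n y x₂ x₃ y' x₂' x₃' hp (by omega) hpn hn hodd h1 h2 h3 h4 h5 h6 hyy' h7)
    a b c a' b' c' hs ha hb hc hs' ha' hb' hc' (jp_at hJP) hH

/-- **THEOREM L, rows p ≥ 13: (U, U) ONLY** (every odd n, p ∤ n; disjoint pair, not all six entries divisible by p). -/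
theorem thirteen_UU (p n a b c a' b' c' : ℕ) (hp : p.Prime) (h13 : 13 ≤ p) (hpn : ¬ p ∣ n) (hn : 0 < n)
    (hodd : Odd n)
    (hs : p * n ∣ a + b + c) (ha : ¬ p * n ∣ a) (hb : ¬ p * n ∣ b) (hc : ¬ p * n ∣ c)
    (hs' : p * n ∣ a' + b' + c') (ha' : ¬ p * n ∣ a') (hb' : ¬ p * n ∣ b') (hc' : ¬ p * n ∣ c')
    (hJP : ¬ (p ∣ a ∧ p ∣ b ∧ p ∣ c ∧ p ∣ a' ∧ p ∣ b' ∧ p ∣ c'))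
    (hD : ∀ u v, (u = a ∨ u = b ∨ u = c) → (v = a' ∨ v = b' ∨ v = c') → ¬ u ≡ v [MOD p * n])
    (hH : SameType (p * n) (a, b, c) (a', b', c')) :
    ¬ p ∣ a ∧ ¬ p ∣ b ∧ ¬ p ∣ c ∧ ¬ p ∣ a' ∧ ¬ p ∣ b' ∧ ¬ p ∣ c' :=
  (thirteen_pattern p n a b c a' b' c' hp h13 hpn hn hodd hs ha hb hc hs' ha' hb' hc' hJP hH).resolve_right
    fun ⟨u, v, hu, hv, _, _, huv⟩ => hD u v hu hv huv

/-! ## 5. The instance p = 5 (every odd n): no (Z3, U); (Z3, Z1) only with 3 ∣ n and the Z1 entry ≡ ±m/3 -/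

/-- transporting "all entries divisible by p" to the normalised triple -/
lemma z3_to {p a b c a₁ b₁ c₁ : ℕ}
    (hperm : (a₁ = a ∧ b₁ = b ∧ c₁ = c) ∨ (a₁ = b ∧ b₁ = a ∧ c₁ = c) ∨ (a₁ = c ∧ b₁ = a ∧ c₁ = b))
    (h : p ∣ a ∧ p ∣ b ∧ p ∣ c) : p ∣ a₁ ∧ p ∣ b₁ ∧ p ∣ c₁ := by
  rcases hperm with ⟨rfl, rfl, rfl⟩ | ⟨rfl, rfl, rfl⟩ | ⟨rfl, rfl, rfl⟩
  · exact h
  · exact ⟨h.2.1, h.1, h.2.2⟩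
  · exact ⟨h.2.2, h.1, h.2.1⟩

/-- the residue of the 5-divisible entry `5y` of a Z1 triple in the shape of `TheoremL.row_Z3Z1_five`: `5y ≡ ±m/3 (mod m)`, m = 5n -/
lemma res_pm_third {n y : ℕ} (h : 3 * Nat.gcd y n = n ∧ (y % n = n / 3 ∨ y % n = 2 * (n / 3))) :
    3 ∣ n ∧ (5 * y % (5 * n) = 5 * n / 3 ∨ 5 * y % (5 * n) = 2 * (5 * n / 3)) := by
  obtain ⟨hg, hy⟩ := h
  refine ⟨⟨Nat.gcd y n, hg.symm⟩, ?_⟩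
  rw [Nat.mul_mod_mul_left]
  rcases hy with hy | hy <;> omega

/-- the case analysis at p = 5 for triples in normal form -/
lemma five_core {n a b c a' b' c' : ℕ} (h5n : ¬ 5 ∣ n) (hn : 0 < n) (hodd : Odd n)
    (hs : 5 * n ∣ a + b + c) (ha : ¬ 5 * n ∣ a) (hs' : 5 * n ∣ a' + b' + c') (ha' : ¬ 5 * n ∣ a')
    (hpat : (¬ 5 ∣ a ∧ ¬ 5 ∣ b ∧ ¬ 5 ∣ c) ∨ (5 ∣ a ∧ ¬ 5 ∣ b ∧ ¬ 5 ∣ c) ∨ (5 ∣ a ∧ 5 ∣ b ∧ 5 ∣ c))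
    (hpat' : (¬ 5 ∣ a' ∧ ¬ 5 ∣ b' ∧ ¬ 5 ∣ c') ∨ (5 ∣ a' ∧ ¬ 5 ∣ b' ∧ ¬ 5 ∣ c') ∨ (5 ∣ a' ∧ 5 ∣ b' ∧ 5 ∣ c'))
    (hJP : ¬ (5 ∣ a ∧ 5 ∣ b ∧ 5 ∣ c ∧ 5 ∣ a' ∧ 5 ∣ b' ∧ 5 ∣ c'))
    (hH : SameType (5 * n) (a, b, c) (a', b', c')) :
    (¬ (5 ∣ a ∧ 5 ∣ b ∧ 5 ∣ c) ∧ ¬ (5 ∣ a' ∧ 5 ∣ b' ∧ 5 ∣ c')) ∨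
    (3 ∣ n ∧ ((5 ∣ a ∧ (a % (5 * n) = 5 * n / 3 ∨ a % (5 * n) = 2 * (5 * n / 3))) ∨
              (5 ∣ a' ∧ (a' % (5 * n) = 5 * n / 3 ∨ a' % (5 * n) = 2 * (5 * n / 3))))) := by
  have hp5 : Nat.Prime 5 := by norm_num
  have ny : ∀ {y : ℕ}, ¬ 5 * n ∣ 5 * y → ¬ n ∣ y := fun h hy => h (Nat.mul_dvd_mul_left 5 hy)
  rcases hpat with hU | hZ1 | hZ3
  · rcases hpat' with hU' | hZ1' | hZ3'
    · exact Or.inl ⟨fun h => hU.1 h.1, fun h => hU'.1 h.1⟩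
    · exact Or.inl ⟨fun h => hU.1 h.1, fun h => hZ1'.2.1 h.2.1⟩
    · obtain ⟨⟨a₀, rfl⟩, ⟨b₀, rfl⟩, ⟨c₀, rfl⟩⟩ := hZ3'
      exact (row_Z3U 5 n a₀ b₀ c₀ a b c hp5 le_rfl h5n hn hs hU.1 hU.2.1 hU.2.2 (st_symm hH)).elim
  · rcases hpat' with hU' | hZ1' | hZ3'
    · exact Or.inl ⟨fun h => hZ1.2.1 h.2.1, fun h => hU'.1 h.1⟩
    · exact Or.inl ⟨fun h => hZ1.2.1 h.2.1, fun h => hZ1'.2.1 h.2.1⟩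
    · -- (Z1, Z3): the Z1 entry of T is ≡ ±m/3
      obtain ⟨⟨y, rfl⟩, hb, hc⟩ := hZ1
      obtain ⟨⟨a₀, rfl⟩, ⟨b₀, rfl⟩, ⟨c₀, rfl⟩⟩ := hZ3'
      have h := row_Z3Z1_five n a₀ b₀ c₀ y b c h5n hn hodd hs hb hc (ny ha) (st_symm hH)
      obtain ⟨h3, hres⟩ := res_pm_third h
      exact Or.inr ⟨h3, Or.inl ⟨⟨y, rfl⟩, hres⟩⟩
  · rcases hpat' with hU' | hZ1' | hZ3'
    · obtain ⟨⟨a₀, rfl⟩, ⟨b₀, rfl⟩, ⟨c₀, rfl⟩⟩ := hZ3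
      exact (row_Z3U 5 n a₀ b₀ c₀ a' b' c' hp5 le_rfl h5n hn hs' hU'.1 hU'.2.1 hU'.2.2 hH).elim
    · -- (Z3, Z1): the Z1 entry of T′ is ≡ ±m/3
      obtain ⟨⟨a₀, rfl⟩, ⟨b₀, rfl⟩, ⟨c₀, rfl⟩⟩ := hZ3
      obtain ⟨⟨y', rfl⟩, hb', hc'⟩ := hZ1'
      have h := row_Z3Z1_five n a₀ b₀ c₀ y' b' c' h5n hn hodd hs' hb' hc' (ny ha') hH
      obtain ⟨h3, hres⟩ := res_pm_third h
      exact Or.inr ⟨h3, Or.inr ⟨⟨y', rfl⟩, hres⟩⟩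
    · exact (hJP ⟨hZ3.1, hZ3.2.1, hZ3.2.2, hZ3'.1, hZ3'.2.1, hZ3'.2.2⟩).elim

/-- **THEOREM L, row p = 5 (final form, every odd n with 5 ∤ n).**  Two zero-sum triples of level `m = 5n` with no entry `≡ 0`,
not all six entries divisible by 5, of the same CM type: EITHER neither triple is Z3 at 5 — the patterns are among (U, U), (U, Z1),
(Z1, Z1), all of which occur — OR (one triple is Z3 at 5, the other is then Z1 at 5, and) 3 ∣ n and a 5-divisible entry is
`≡ ±m/3 (mod m)`: the rows (Z3, U) "impossible" (`TheoremL.row_Z3U`) and (Z3, Z1) "x₁′ = ±m/3" (`TheoremL.row_Z3Z1_five`) of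
THEOREM L at p = 5, packaged. -/
theorem five_pattern (n a b c a' b' c' : ℕ) (h5n : ¬ 5 ∣ n) (hn : 0 < n) (hodd : Odd n)
    (hs : 5 * n ∣ a + b + c) (ha : ¬ 5 * n ∣ a) (hb : ¬ 5 * n ∣ b) (hc : ¬ 5 * n ∣ c)
    (hs' : 5 * n ∣ a' + b' + c') (ha' : ¬ 5 * n ∣ a') (hb' : ¬ 5 * n ∣ b') (hc' : ¬ 5 * n ∣ c')
    (hJP : ¬ (5 ∣ a ∧ 5 ∣ b ∧ 5 ∣ c ∧ 5 ∣ a' ∧ 5 ∣ b' ∧ 5 ∣ c'))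
    (hH : SameType (5 * n) (a, b, c) (a', b', c')) :
    (¬ (5 ∣ a ∧ 5 ∣ b ∧ 5 ∣ c) ∧ ¬ (5 ∣ a' ∧ 5 ∣ b' ∧ 5 ∣ c')) ∨
    (3 ∣ n ∧ ∃ v, (v = a ∨ v = b ∨ v = c ∨ v = a' ∨ v = b' ∨ v = c') ∧ 5 ∣ v ∧
      (v % (5 * n) = 5 * n / 3 ∨ v % (5 * n) = 2 * (5 * n / 3))) := by
  have hN : 0 < 5 * n := by omega
  have hpN : 5 ∣ 5 * n := dvd_mul_right 5 n
  obtain ⟨a₁, b₁, c₁, hperm, hS, hs₁, ha₁, hb₁, hc₁, hz₁, hp₁⟩ := normalise (p := 5) hN hpN hs ha hb hc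
  obtain ⟨a₂, b₂, c₂, hperm', hS', hs₂, ha₂, hb₂, hc₂, hz₂, hp₂⟩ := normalise (p := 5) hN hpN hs' ha' hb' hc'
  have hH₁ : SameType (5 * n) (a₁, b₁, c₁) (a₂, b₂, c₂) := st_trans hS (st_trans hH (st_symm hS'))
  have hJP₁ : ¬ (5 ∣ a₁ ∧ 5 ∣ b₁ ∧ 5 ∣ c₁ ∧ 5 ∣ a₂ ∧ 5 ∣ b₂ ∧ 5 ∣ c₂) := by
    rintro ⟨h1, h2, h3, h4, h5, h6⟩
    obtain ⟨k1, k2, k3⟩ := hz₁ 5 h1 h2 h3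
    obtain ⟨k4, k5, k6⟩ := hz₂ 5 h4 h5 h6
    exact hJP ⟨k1, k2, k3, k4, k5, k6⟩
  rcases five_core h5n hn hodd hs₁ ha₁ hs₂ ha₂ hp₁ hp₂ hJP₁ hH₁ with ⟨h1, h2⟩ | ⟨h3, hv⟩
  · exact Or.inl ⟨fun h => h1 (z3_to hperm h), fun h => h2 (z3_to hperm' h)⟩
  · refine Or.inr ⟨h3, ?_⟩
    rcases hv with ⟨hd, hr⟩ | ⟨hd, hr⟩
    · refine ⟨a₁, ?_, hd, hr⟩
      rcases mem_back hperm with h | h | h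
      · exact Or.inl h
      · exact Or.inr (Or.inl h)
      · exact Or.inr (Or.inr (Or.inl h))
    · refine ⟨a₂, ?_, hd, hr⟩
      rcases mem_back hperm' with h | h | h
      · exact Or.inr (Or.inr (Or.inr (Or.inl h)))
      · exact Or.inr (Or.inr (Or.inr (Or.inr (Or.inl h))))
      · exact Or.inr (Or.inr (Or.inr (Or.inr (Or.inr h))))

end HodgeFermat.KRFree.RowsFinal
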